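import Summits.NavierStokesRegularity.FluidComputer.GateBudget
import HarnessLib

/-!
# What no tuning can beat, part 2 of 3: THE ARMING LAW (no output before the amplifier has supplied
# `log(κ/(Rσ))` e-folds; for Tao's family: no output before `≈ √2`, whatever the drain and the amplitude)

Cell `pub-fluidc`, blueprint seat bp1 (gen 21); part 2 of ONE text (`GateBudget.lean`, this file,
`GateBudgetZeno.lean`); namespace `Summit.NavierStokesRegularity.FluidComputer.GateBudget`. HONEST FRAMING
(verbatim): low prior, high value-of-information experiment on Tao's machine paradigm; NOT a claim that NS blows
up. Five-mode quadratic ODEs on `ℝ⁵` (`fiveGateCircuit ε σ μ R K` of part 1; Tao's (5.5) is the slice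
`σ = ε²e^{-M}, μ = ε⁻¹M, R = ε⁻²`, `M = K¹⁰`) started EXACTLY at (5.6); nothing is proved about Navier–Stokes.

THIS FILE. `trigger_le_arming`: the swept trigger of Tao's caricature (i) is a SUPER-solution for every
trajectory, `c(t) ≤ σt·e^{μ(ε+σ)t²/2}` (`∂ₜc = σa² + μbc ≤ σ + μ(ε+σ)t·c` by part 1's trigger budget
`b ≤ (ε+σ)t` and `c ≥ 0`). `output_le_arming`: hence `√(d²+ã²)(t) ≤ (Rσ/κ)(e^{κt²/2} - 1)`, `κ = μ(ε+σ)`, by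
part 1's square-root comparison applied to `∂ₜ(d²+ã²) = 2Rcad`. `taoFamily_no_early_output`: for
`delayCircuitWith K M ε` (`M ≥ 1`, `0 < ε ≤ 1`, ANY `K`) and `0 ≤ t ≤ √2`: `ã(t) ≤ (e/M)·e^{-M(1 - t²/2)}` — at
`t = √(2(1-η))` the output is `≤ (e/M)e^{-ηM}`. So the delay `√2` of [Tao2016AveragedNS, Theorem 5.3 (j)] is
a one-sided LAW of the seed/amplifier ratio `e^{-M}`, holding for every drain and amplitude (the tree's
`Thm53With.tc_window` locates the threshold crossing in `2 - 24 log K/M ≤ t_c² ≤ 2 + 2/M` under `K ≥ 16`,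
`48 log K ≤ M ≤ K¹⁰`, `ε² ≤ 1/(6K²⁰)`); in particular `ã(t) ≤ e/M` for `t ≤ √2`
(`taoFamily_output_before_sqrt_two`), and with NO seed pump nothing ever fires (`no_seed_no_output`). Part 3
turns the budgets into the rotor / drain / amplifier / amplitude NECESSITY inequalities.
[cite: Tao2016AveragedNS, §5.5 Thm 5.3 (j), caricature (i)–(iii), (code)]. No named facts; 0 sorry.
-/

noncomputable section

namespace Summit.NavierStokesRegularity.FluidComputer.GateBudget

open Real Set Filter Topology
open Literature.Analysis.FluidPDE.Tao2016AveragedNS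
open Literature.Analysis.FluidPDE.Tao2016AveragedNS.Thm53 (antitoneOn_intFactor monotoneOn_intFactor
  antitoneOn_sub_of_deriv_le monotoneOn_sub_of_le_deriv init_a init_b init_c init_d init_e)

variable {ε σ μ R K : ℝ} {X : ℝ → Fin 5 → ℝ}

/-! ## §5 The arming law: no output before the amplifier has supplied `log(κ/(Rσ))` e-folds -/

/-- **The swept trigger is a super-solution**: `c(t) ≤ σt·exp(μ(ε+σ)t²/2)` for `t ≥ 0` (`ε, σ, μ ≥ 0`), from
`∂ₜc = σa² + μbc ≤ σ + μ(ε+σ)t·c` (`a² ≤ 1`, `c ≥ 0`, `b ≤ (ε+σ)t`). This is Tao's caricature (i)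
"`c` grows like `ε²exp((t²/2 - 1)K¹⁰)`" as a one-sided THEOREM for every trajectory.
[cite: Tao2016AveragedNS, §5.5 caricature (i), (code)] -/
theorem trigger_le_arming (hX : ∀ t, HasDerivAt X (fiveGateCircuit ε σ μ R K (X t)) t)
    (h0 : X 0 = delayInit) (hε : 0 ≤ ε) (hσ : 0 ≤ σ) (hμ : 0 ≤ μ) {t : ℝ} (ht : 0 ≤ t) :
    X t 2 ≤ σ * t * exp (μ * (ε + σ) * t ^ 2 / 2) := by
  have hanti := antitoneOn_intFactor (s := Ici 0) (f := fun s => X s 2)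
    (f' := fun s => σ * X s 0 ^ 2 + μ * X s 1 * X s 2) (g := fun s => μ * (ε + σ) * s)
    (G := fun s => μ * (ε + σ) * s ^ 2 / 2) (φ := fun _ => σ) (Φ := fun s => σ * s) (convex_Ici 0)
    (fun s _ => hasDerivAt_c hX s) (fun s _ => hasDerivAt_sq_half (μ * (ε + σ)) s)
    (fun s _ => ((hasDerivAt_id' s).const_mul σ).congr_deriv (by simp)) (fun s hs => by
      have hs0 : 0 ≤ s := hs
      have ha : X s 0 ^ 2 ≤ 1 := traj_sq_le_one hX h0 s 0
      have hc0 : 0 ≤ X s 2 := c_nonneg hX h0 hσ hs0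
      have hb : X s 1 ≤ (ε + σ) * s := (le_abs_self _).trans (abs_b_le hX h0 hε hσ hs0)
      have hG0 : 0 ≤ μ * (ε + σ) * s ^ 2 / 2 := by positivity
      have hexp : exp (-(μ * (ε + σ) * s ^ 2 / 2)) ≤ 1 := by
        rw [exp_le_one_iff]; linarith
      have hexp0 : 0 < exp (-(μ * (ε + σ) * s ^ 2 / 2)) := exp_pos _
      -- the bracket is at most `σ`
      have hbr : σ * X s 0 ^ 2 + μ * X s 1 * X s 2 - μ * (ε + σ) * s * X s 2 ≤ σ := by
        have e1 : μ * X s 2 * (X s 1 - (ε + σ) * s) ≤ 0 :=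
          mul_nonpos_of_nonneg_of_nonpos (mul_nonneg hμ hc0) (by linarith)
        nlinarith [mul_le_mul_of_nonneg_left ha hσ]
      rcases le_or_gt 0 (σ * X s 0 ^ 2 + μ * X s 1 * X s 2 - μ * (ε + σ) * s * X s 2) with hpos | hneg
      · calc (σ * X s 0 ^ 2 + μ * X s 1 * X s 2 - μ * (ε + σ) * s * X s 2)
              * exp (-(μ * (ε + σ) * s ^ 2 / 2))
            ≤ (σ * X s 0 ^ 2 + μ * X s 1 * X s 2 - μ * (ε + σ) * s * X s 2) * 1 :=
              mul_le_mul_of_nonneg_left hexp hpos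
          _ ≤ σ := by linarith
      · have : (σ * X s 0 ^ 2 + μ * X s 1 * X s 2 - μ * (ε + σ) * s * X s 2)
            * exp (-(μ * (ε + σ) * s ^ 2 / 2)) ≤ 0 :=
          mul_nonpos_of_nonpos_of_nonneg hneg.le hexp0.le
        linarith)
  have h := hanti (mem_Ici.2 le_rfl) (mem_Ici.2 ht) ht
  simp only [init_c h0, zero_mul, mul_zero, sub_zero] at h
  -- h : c t · e^{-G t} - σ t ≤ 0
  have hE : 0 < exp (-(μ * (ε + σ) * t ^ 2 / 2)) := exp_pos _
  have h1 : X t 2 * exp (-(μ * (ε + σ) * t ^ 2 / 2)) ≤ σ * t := by linarith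
  have h2 : X t 2 = X t 2 * exp (-(μ * (ε + σ) * t ^ 2 / 2)) * exp (μ * (ε + σ) * t ^ 2 / 2) := by
    rw [mul_assoc, ← exp_add, neg_add_cancel, exp_zero, mul_one]
  rw [h2]
  exact mul_le_mul_of_nonneg_right h1 (exp_pos _).le

/-- **THE ARMING LAW for the output.** With `κ = μ(ε+σ) > 0`: `√(d²+ã²)(t) ≤ (Rσ/κ)(e^{κt²/2} - 1)` for
`t ≥ 0` — from `∂ₜ(d²+ã²) = 2Rcad ≤ 2R·σs·e^{κs²/2}·√(d²+ã²)` and `∫₀ᵗ σs e^{κs²/2} ds = σ(e^{κt²/2}-1)/κ`.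
The output is exponentially small until the swept amplifier has made up the `log(κ/(Rσ))` e-folds separating
the seed from the rotor: this is the DELAY, as a one-sided law valid for every drain `K`.
[cite: Tao2016AveragedNS, §5.5 caricature (i)–(iii)] -/
theorem output_le_arming (hX : ∀ t, HasDerivAt X (fiveGateCircuit ε σ μ R K (X t)) t)
    (h0 : X 0 = delayInit) (hε : 0 ≤ ε) (hσ : 0 ≤ σ) (hμ : 0 ≤ μ) (hR : 0 ≤ R)
    (hκ : 0 < μ * (ε + σ)) {t : ℝ} (ht : 0 ≤ t) :
    sqrt (X t 3 ^ 2 + X t 4 ^ 2)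
      ≤ R * σ / (μ * (ε + σ)) * (exp (μ * (ε + σ) * t ^ 2 / 2) - 1) := by
  set κ := μ * (ε + σ) with hκdef
  have hGd : ∀ s, HasDerivAt (fun r => R * σ / κ * exp (κ * r ^ 2 / 2)) (R * σ * s * exp (κ * s ^ 2 / 2)) s := by
    intro s
    have h := ((hasDerivAt_sq_half κ s).exp).const_mul (R * σ / κ)
    refine h.congr_deriv ?_
    field_simp
  have h := sqrt_le_of_deriv_le (W := fun s => X s 3 ^ 2 + X s 4 ^ 2)
    (w := fun s => 2 * R * X s 2 * X s 0 * X s 3) (g := fun s => R * σ * s * exp (κ * s ^ 2 / 2))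
    (G := fun s => R * σ / κ * exp (κ * s ^ 2 / 2))
    (fun s _ => out_energy (hX s)) (fun s _ => hGd s)
    (fun s _ => by positivity) (fun s hs => by positivity) (fun s hs => ?_) ht
  · have h0' : (0:ℝ) ^ 2 = 0 := by norm_num
    simp only [init_d h0, init_e h0, h0', mul_zero, zero_div, exp_zero, mul_one, add_zero, sqrt_zero,
      zero_add] at h
    calc sqrt (X t 3 ^ 2 + X t 4 ^ 2) ≤ R * σ / κ * exp (κ * t ^ 2 / 2) - R * σ / κ := h
      _ = R * σ / κ * (exp (κ * t ^ 2 / 2) - 1) := by ring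
  · set V := sqrt (X s 3 ^ 2 + X s 4 ^ 2) with hV
    have hd : |X s 3| ≤ V := abs_le_sqrt (by nlinarith [sq_nonneg (X s 4)])
    have hc0 : 0 ≤ X s 2 := c_nonneg hX h0 hσ hs
    have hc : X s 2 ≤ σ * s * exp (κ * s ^ 2 / 2) := trigger_le_arming hX h0 hε hσ hμ hs
    have ha : |X s 0| ≤ 1 := traj_abs_le_one hX h0 s 0
    have h3 : X s 2 * X s 0 * X s 3 ≤ σ * s * exp (κ * s ^ 2 / 2) * V := by
      have hle : X s 2 * (X s 0 * X s 3) ≤ X s 2 * |X s 0 * X s 3| :=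
        mul_le_mul_of_nonneg_left (le_abs_self _) hc0
      have hle2 : |X s 0 * X s 3| ≤ 1 * V := by
        rw [abs_mul]; exact mul_le_mul ha hd (abs_nonneg _) zero_le_one
      have hle3 : X s 2 * |X s 0 * X s 3| ≤ σ * s * exp (κ * s ^ 2 / 2) * (1 * V) :=
        mul_le_mul hc hle2 (abs_nonneg _) (by positivity)
      calc X s 2 * X s 0 * X s 3 = X s 2 * (X s 0 * X s 3) := by ring
        _ ≤ σ * s * exp (κ * s ^ 2 / 2) * (1 * V) := hle.trans hle3
        _ = σ * s * exp (κ * s ^ 2 / 2) * V := by ring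
    show 2 * R * X s 2 * X s 0 * X s 3 ≤ 2 * (R * σ * s * exp (κ * s ^ 2 / 2)) * V
    nlinarith [mul_le_mul_of_nonneg_left h3 hR]

/-- **Tao's family: no output before `≈ √2`, whatever the drain and the amplitude.** Along every exact
trajectory of `delayCircuitWith K M ε` from (5.6) with `M ≥ 1`, `0 < ε ≤ 1` and ANY real `K`, for `0 ≤ t ≤ √2`:
`ã(t) ≤ (e/M)·exp(-M(1 - t²/2))`. (Here `κ = M(1 + εe^{-M})`, `Rσ/κ = e^{-M}/(M(1+εe^{-M})) ≤ e^{-M}/M` and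
`κt²/2 ≤ Mt²/2 + e^{-M}M ≤ Mt²/2 + 1`.) At `t = √(2(1-η))` the output is `≤ (e/M)e^{-ηM}`: the delay `√2` of
Theorem 5.3 is forced by the seed/amplifier ratio alone. [cite: Tao2016AveragedNS, §5.5 Thm 5.3 (j), caricature (i)] -/
theorem taoFamily_no_early_output {K M ε : ℝ} {X : ℝ → Fin 5 → ℝ}
    (hX : ∀ t, HasDerivAt X (delayCircuitWith K M ε (X t)) t) (h0 : X 0 = delayInit)
    (hM : 1 ≤ M) (hε : 0 < ε) (hε1 : ε ≤ 1) {t : ℝ} (ht : 0 ≤ t) (ht2 : t ^ 2 ≤ 2) :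
    X t 4 ≤ exp 1 / M * exp (-(M * (1 - t ^ 2 / 2))) := by
  rw [delayCircuitWith_eq_fiveGate] at hX
  have hM0 : 0 < M := by linarith
  have hσ : 0 ≤ ε ^ 2 * exp (-M) := by positivity
  have hμ : 0 ≤ ε⁻¹ * M := by positivity
  have hR : 0 ≤ (ε ^ 2)⁻¹ := by positivity
  set κ := ε⁻¹ * M * (ε + ε ^ 2 * exp (-M)) with hκdef
  have hκM : κ = M * (1 + ε * exp (-M)) := by
    rw [hκdef]; field_simp
  have hκ : 0 < κ := by rw [hκM]; positivity
  have h := output_le_arming hX h0 hε.le hσ hμ hR hκ ht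
  have he : X t 4 ≤ sqrt (X t 3 ^ 2 + X t 4 ^ 2) :=
    (le_abs_self _).trans (abs_le_sqrt (by nlinarith [sq_nonneg (X t 3)]))
  -- the prefactor `Rσ/κ = e^{-M}/(M(1+εe^{-M})) ≤ e^{-M}/M`
  have hpre : (ε ^ 2)⁻¹ * (ε ^ 2 * exp (-M)) / κ ≤ exp (-M) / M := by
    have : (ε ^ 2)⁻¹ * (ε ^ 2 * exp (-M)) = exp (-M) := by field_simp
    rw [this, hκM]
    apply div_le_div_of_nonneg_left (exp_pos _).le hM0
    have : 0 ≤ M * (ε * exp (-M)) := by positivity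
    linarith
  -- the exponent `κt²/2 ≤ Mt²/2 + 1`
  have hexpo : κ * t ^ 2 / 2 ≤ M * t ^ 2 / 2 + 1 := by
    rw [hκM]
    have h1 : exp (-M) * M ≤ 1 := by
      have := add_one_le_exp M   -- M + 1 ≤ e^M
      have hEM : exp (-M) * exp M = 1 := by rw [← exp_add, neg_add_cancel, exp_zero]
      nlinarith [exp_pos (-M), exp_pos M]
    have h2 : M * (ε * exp (-M)) * t ^ 2 / 2 ≤ exp (-M) * M := by
      have : ε * t ^ 2 / 2 ≤ 1 := by nlinarith
      have h3 : M * (ε * exp (-M)) * t ^ 2 / 2 = (exp (-M) * M) * (ε * t ^ 2 / 2) := by ring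
      rw [h3]
      exact mul_le_of_le_one_right (by positivity) this
    nlinarith
  have hmono : exp (κ * t ^ 2 / 2) - 1 ≤ exp (M * t ^ 2 / 2 + 1) := by
    have := exp_le_exp.2 hexpo; linarith [exp_pos (κ * t ^ 2 / 2)]
  have hpre0 : 0 ≤ (ε ^ 2)⁻¹ * (ε ^ 2 * exp (-M)) / κ := by positivity
  calc X t 4 ≤ (ε ^ 2)⁻¹ * (ε ^ 2 * exp (-M)) / κ * (exp (κ * t ^ 2 / 2) - 1) := he.trans h
    _ ≤ exp (-M) / M * exp (M * t ^ 2 / 2 + 1) :=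
        mul_le_mul hpre hmono (by linarith [exp_pos (κ * t ^ 2 / 2), (one_le_exp_iff).2 (by positivity :
          (0:ℝ) ≤ κ * t ^ 2 / 2)]) (by positivity)
    _ = exp 1 / M * exp (-(M * (1 - t ^ 2 / 2))) := by
        rw [div_mul_eq_mul_div, div_mul_eq_mul_div, ← exp_add, ← exp_add]
        congr 1; ring_nf

/-- **Before `√2` the output of Tao's family is at most `e/M`** (for (5.5): `e/K¹⁰`) — for every drain `K`
and every amplitude `0 < ε ≤ 1`. [cite: Tao2016AveragedNS, §5.5 Thm 5.3 (j)] -/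
theorem taoFamily_output_before_sqrt_two {K M ε : ℝ} {X : ℝ → Fin 5 → ℝ}
    (hX : ∀ t, HasDerivAt X (delayCircuitWith K M ε (X t)) t) (h0 : X 0 = delayInit)
    (hM : 1 ≤ M) (hε : 0 < ε) (hε1 : ε ≤ 1) {t : ℝ} (ht : 0 ≤ t) (ht2 : t ^ 2 ≤ 2) :
    X t 4 ≤ exp 1 / M := by
  have h := taoFamily_no_early_output hX h0 hM hε hε1 ht ht2
  have hM0 : 0 < M := by linarith
  have h2 : exp (-(M * (1 - t ^ 2 / 2))) ≤ 1 := by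
    rw [exp_le_one_iff, neg_nonpos]
    exact mul_nonneg hM0.le (by linarith)
  calc X t 4 ≤ exp 1 / M * exp (-(M * (1 - t ^ 2 / 2))) := h
    _ ≤ exp 1 / M * 1 := mul_le_mul_of_nonneg_left h2 (by positivity)
    _ = exp 1 / M := mul_one _

/-- **No seed, no output.** Without the seed pump (`σ = 0`; clock `ε > 0`, amplifier `μ > 0`, rotor `R ≥ 0`,
any drain) the trigger and the output pair vanish identically for `t ≥ 0` along the trajectory from (5.6):
an amplifier cannot ignite a mode that is exactly zero, so the arming law with `σ = 0` gives
`c = d = ã = 0`. [cite: Tao2016AveragedNS, §5.3, §5.5] -/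
theorem no_seed_no_output (hX : ∀ t, HasDerivAt X (fiveGateCircuit ε 0 μ R K (X t)) t)
    (h0 : X 0 = delayInit) (hε : 0 < ε) (hμ : 0 < μ) (hR : 0 ≤ R) {t : ℝ} (ht : 0 ≤ t) :
    X t 2 = 0 ∧ X t 3 = 0 ∧ X t 4 = 0 := by
  have hκ : 0 < μ * (ε + 0) := by rw [add_zero]; exact mul_pos hμ hε
  have h := output_le_arming hX h0 hε.le le_rfl hμ.le hR hκ ht
  have hz : R * 0 / (μ * (ε + 0)) * (exp (μ * (ε + 0) * t ^ 2 / 2) - 1) = 0 := by ring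
  rw [hz] at h
  have hsum : X t 3 ^ 2 + X t 4 ^ 2 ≤ 0 := sqrt_eq_zero'.1 (le_antisymm h (sqrt_nonneg _))
  have hc0 : 0 ≤ X t 2 := c_nonneg hX h0 le_rfl ht
  have hc : X t 2 ≤ 0 * t * exp (μ * (ε + 0) * t ^ 2 / 2) := trigger_le_arming hX h0 hε.le le_rfl hμ.le ht
  rw [zero_mul, zero_mul] at hc
  refine ⟨le_antisymm hc hc0, ?_, ?_⟩
  · nlinarith [sq_nonneg (X t 3), sq_nonneg (X t 4)]
  · nlinarith [sq_nonneg (X t 3), sq_nonneg (X t 4)]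

end Summit.NavierStokesRegularity.FluidComputer.GateBudget
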